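import Summits.CriticalPhenomena.PercolationContinuityZ3.Theorems.FK.InfiniteVolumeDLRJoinGraph
import Summits.CriticalPhenomena.PercolationContinuityZ3.Theorems.FK.InfiniteVolumeDLRPowersetTilt
import Summits.CriticalPhenomena.PercolationContinuityZ3.Theorems.FK.InfiniteVolumeDLRRegionTransport
import HarnessLib

/-!
# FK-continuity transplant, FO-06/FO-10 (infinite-volume structure): the specification kernel `φ^ξ_{Λ,p,q}` is
# INCREASING in the boundary condition `ξ` and lies between `φ⁰_Λ` and `φ¹_Λ` — Grimmett 2006, Lemma (4.14)(a)(b) for (4.12)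

Registered R80 (cell INBOX l.5895, 2026-08-23); registry row FO-10b-g407k; label KCM-D (coordinator fk-4 g175).
Cell `fk-continuity` (bschramm), FO-10b lineage; support file for the FK-continuity transplant
(`--supports stmt-CriticalPhenomena-4575`); builds on p205010 (kernel theorem, internal audit signed; external expert
review pending). No named facts, no definitions, no sorries, standard axioms. Banked infinite-volume structure; not an
END-STATE dependency of the cell (not consumed by `_r3`); it says nothing about FH / TP_FK or continuity at `p_c`.

For `0 ≤ p ≤ 1`, `q ≥ 1`, a finite region `Λ` and an increasing event `A` (read on the patterns `η ⊆ E_Λ` through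
`↑η ∈ A`; `∑_{η ∈ A} φ^ξ_Λ(η)` is written `∑_{η ⊆ E_Λ} (if ↑η ∈ A then rcCondProb p q Λ ξ η else 0)`):

* **`sum_ite_rcCondProb_mono`** — Lemma (4.14)(a) for the kernel: `ξ ⊆ ξ'` (ARBITRARY sets of pairs) implies
  `∑_{η ∈ A} φ^ξ_{Λ,p,q}(η) ≤ ∑_{η ∈ A} φ^{ξ'}_{Λ,p,q}(η)` — more outside connections raise increasing expectations;
* `regionFreeReal_le_sum_ite_rcCondProb` — Lemma (4.14)(b), free half, for EVERY configuration `ξ`: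
  `φ⁰_{Λ,p,q}(A) ≤ ∑_{η ∈ A} φ^ξ_{Λ,p,q}(η)`;
* `comap_fromRel_reachable_le_wired_wiredBoundary` — for a LATTICE configuration `ξ` the `ξ`-connections off `E_Λ`
  only join vertices of the inner vertex boundary `∂Λ`;
* `sum_ite_rcCondProb_le_regionWiredReal` — Lemma (4.14)(b), wired half, for every lattice `ξ`:
  `∑_{η ∈ A} φ^ξ_{Λ,p,q}(η) ≤ φ¹_{Λ,p,q}(A)`.

Proof: the kernel weight is the random-cluster weight on `(Λ, E_Λ)` with the boundary-condition GRAPH `R_ξ` (the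
`ξ ∖ E_Λ`-connection graph pulled back to `↥Λ`, `InfiniteVolumeDLRJoinGraph.lean`), more wiring raises increasing
expectations (`powerset_tilt_sum_mul_sum_le`, `InfiniteVolumeDLRPowersetTilt.lean`), and
`⊥ ≤ R_ξ ≤ R_{ξ'}`, `R_ξ ≤ wired ∂Λ` for lattice `ξ`. The (b)-halves for lattice `ξ` and `0 < p < 1` are also
obtained, by a different route (the exact box-kernel identity off the bad event), in row FO-10a's
`DLRKernelSandwich.lean` / `DLRSandwich.lean` (`regionFreeReal_le_sum_rcCondProb`, `sum_rcCondProb_le_regionWiredReal`);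
the present file is the Holley/FKG-lattice route of Grimmett's text, covers `p ∈ {0, 1}` and an arbitrary `ξ` on the
free side, and adds the monotonicity (a).

## References

* G. Grimmett, *The Random-Cluster Model*, Springer 2006: Thm. (3.8) eq. (3.12), Lemma (4.13), Lemma (4.14)(a)(b),
  Thm. (4.34)(b) eq. (4.35). [Grimmett2006]
-/

noncomputable section

open Finset MeasureTheory

namespace Summit.CriticalPhenomena.PercolationContinuityZ3.Theorems.FK

open Literature.Probability.Percolation Literature.Probability.LatticeModels

variable {d : ℕ} {p q : ℝ}

/-- The kernel weight with the Finset-subtype vertex type `↥Λ` (syntactic variant of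
`rcCondWeight_eq_pow_card_comap`, glued with `wired ∅ = ⊥` for alignment with the region laws). [cite: Grimmett2006, §4.2 (4.12)] -/
theorem rcCondWeight_eq_pow_card_comap_wired_empty (p q : ℝ) (Λ : Finset (Site d)) (ξ : BondConfig (Site d))
    {η : Finset (Sym2 (Site d))} (hη : η ⊆ edgesIn (zdGraph d) Λ) :
    rcCondWeight p q Λ ξ η = p ^ η.card * (1 - p) ^ (edgesIn (zdGraph d) Λ \ η).card *
      q ^ Nat.card ((openGraph (↑η : BondConfig (Site d))).comap (Subtype.val : ↥Λ → Site d) ⊔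
        (wired (∅ : Set ↥Λ) ⊔ (SimpleGraph.fromRel (openGraph (ξ \ ↑(edgesIn (zdGraph d) Λ))).Reachable).comap
          (Subtype.val : ↥Λ → Site d))).ConnectedComponent := by
  rw [wired_empty, bot_sup_eq]
  exact rcCondWeight_eq_pow_card_comap p q Λ ξ hη

/-- **Pointwise lower kernel comparison** (Grimmett 2006, Lemma (4.14)(b), free side, general boundary condition):
for `0 ≤ p ≤ 1`, `q ≥ 1`, a finite region `Λ`, ANY configuration `ξ` and an increasing event `A`,
`φ⁰_{Λ,p,q}(A) ≤ ∑_{η ⊆ E_Λ, η ∈ A} φ^ξ_{Λ,p,q}(η)`. [cite: Grimmett2006, Lemma (4.14)(b)] -/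
theorem regionFreeReal_le_sum_ite_rcCondProb (hp : p ∈ Set.Icc (0 : ℝ) 1) (hq : 1 ≤ q) (Λ : Finset (Site d))
    (ξ : BondConfig (Site d)) {A : Set (BondConfig (Site d))} [DecidablePred (· ∈ A)] (hA : IsUpperSet A) :
    regionFreeReal d p q Λ A ≤
      ∑ η ∈ (edgesIn (zdGraph d) Λ).powerset, if (↑η : BondConfig (Site d)) ∈ A then rcCondProb p q Λ ξ η else 0 := by
  classical
  have hq0 : 0 < q := one_pos.trans_le hq
  set U := edgesIn (zdGraph d) Λ with hU
  set R' : SimpleGraph ↥Λ := (SimpleGraph.fromRel (openGraph (ξ \ ↑U)).Reachable).comap (Subtype.val : ↥Λ → Site d)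
    with hR'
  set k : Finset (Sym2 (Site d)) → ℕ := fun η =>
    Nat.card ((openGraph (↑η : BondConfig (Site d))).comap (Subtype.val : ↥Λ → Site d) ⊔
      wired (∅ : Set ↥Λ)).ConnectedComponent with hk
  set k' : Finset (Sym2 (Site d)) → ℕ := fun η =>
    Nat.card ((openGraph (↑η : BondConfig (Site d))).comap (Subtype.val : ↥Λ → Site d) ⊔
      (wired (∅ : Set ↥Λ) ⊔ R')).ConnectedComponent with hk'
  set f : Finset (Sym2 (Site d)) → ℝ := fun η => if (↑η : BondConfig (Site d)) ∈ A then 1 else 0 with hf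
  have hf0 : ∀ η, 0 ≤ f η := fun η => by simp only [hf]; split_ifs <;> norm_num
  have hfmono : Monotone f := by
    intro a b hab
    simp only [hf]
    by_cases ha : (↑a : BondConfig (Site d)) ∈ A
    · rw [if_pos ha, if_pos (hA (Finset.coe_subset.2 hab) ha)]
    · rw [if_neg ha]; split_ifs <;> norm_num
  have htilt := powerset_tilt_sum_mul_sum_le U hp hq k k'
    (fun a _ b _ => card_cc_comap_sup_supermodular Subtype.val (wired (∅ : Set ↥Λ)) a b)
    (fun a b hab _ => card_cc_comap_add_sup_le Subtype.val (wired (∅ : Set ↥Λ)) R' hab) hf0 hfmono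
  -- denominators
  set Z := ∑ η ∈ U.powerset, p ^ η.card * (1 - p) ^ (U \ η).card * q ^ k η with hZ
  set Z' := ∑ η ∈ U.powerset, p ^ η.card * (1 - p) ^ (U \ η).card * q ^ k' η with hZ'
  have hZ'eq : Z' = rcCondPartition p q Λ ξ := by
    rw [rcCondPartition_eq]
    refine Finset.sum_congr rfl fun η hη => ?_
    rw [rcCondWeight_eq_pow_card_comap_wired_empty p q Λ ξ (Finset.mem_powerset.1 hη)]
  have hZ'pos : 0 < Z' := by rw [hZ'eq]; exact rcCondPartition_pos hp hq0 Λ ξ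
  have hZeq : Z = rcPartitionFunction (finsetGraph (zdGraph d) Λ) p q ∅ :=
    (rcPartitionFunction_finsetGraph_eq_sum Λ ∅).symm
  have hZpos : 0 < Z := by rw [hZeq]; exact rcPartitionFunction_pos _ hp hq0 ∅
  -- the free side as a pattern sum
  have hfree : regionFreeReal d p q Λ A =
      (∑ η ∈ U.powerset, p ^ η.card * (1 - p) ^ (U \ η).card * q ^ k η * f η) / Z := by
    rw [regionFreeReal_eq_sum_div hp hq0 Λ A]
    congr 1
    refine Finset.sum_congr rfl fun η _ => ?_
    simp only [hf]
    split_ifs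
    · rw [mul_one]
    · rw [mul_zero]
  -- the kernel side as a pattern sum
  have hker : ∑ η ∈ U.powerset, (if (↑η : BondConfig (Site d)) ∈ A then rcCondProb p q Λ ξ η else 0) =
      (∑ η ∈ U.powerset, p ^ η.card * (1 - p) ^ (U \ η).card * q ^ k' η * f η) / Z' := by
    rw [Finset.sum_div]
    refine Finset.sum_congr rfl fun η hη => ?_
    rw [rcCondProb_eq, ← hZ'eq, rcCondWeight_eq_pow_card_comap_wired_empty p q Λ ξ (Finset.mem_powerset.1 hη)]
    simp only [hf]
    split_ifs
    · rw [mul_one]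
    · rw [mul_zero, zero_div]
  rw [hfree, hker, div_le_div_iff₀ hZpos hZ'pos]
  linarith [htilt]


/-- For a LATTICE configuration `ξ`, two distinct vertices of `Λ` joined by a `ξ`-open path off `E_Λ` both lie on
the inner vertex boundary `∂Λ` (the first and the last edge of such a path leave `Λ`). Hence the pulled-back
`ξ`-connection graph is below the wiring of `∂Λ`. [cite: Grimmett2006, §4.2 (4.12), Lemma (4.14)(b)] -/
theorem comap_fromRel_reachable_le_wired_wiredBoundary (Λ : Finset (Site d)) {ξ : BondConfig (Site d)}
    (hξ : ξ ⊆ (zdGraph d).edgeSet) :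
    (SimpleGraph.fromRel (openGraph (ξ \ ↑(edgesIn (zdGraph d) Λ))).Reachable).comap (Subtype.val : ↥Λ → Site d) ≤
      wired (wiredBoundary (zdGraph d) Λ) := by
  classical
  -- the first step of an outside path from a vertex of `Λ` leaves `Λ`
  have hfirst : ∀ (a : ↥Λ) (v : Site d), (openGraph (ξ \ ↑(edgesIn (zdGraph d) Λ))).Adj a v →
      (a : Site d) ∈ innerBoundary (zdGraph d) Λ := by
    intro a v hav
    rw [openGraph_adj] at hav
    obtain ⟨⟨hξmem, hU⟩, hne⟩ := hav
    have hadj : (zdGraph d).Adj a v := (SimpleGraph.mem_edgeSet _).1 (hξ hξmem)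
    have hv : v ∉ Λ := by
      intro hv
      apply hU
      rw [Finset.mem_coe, mem_edgesIn_iff]
      refine ⟨hξ hξmem, fun w hw => ?_⟩
      rcases Sym2.mem_iff.1 hw with rfl | rfl
      · exact a.2
      · exact hv
    exact mem_innerBoundary_iff.2 ⟨a.2, v, hv, hadj⟩
  have hstart : ∀ (a : ↥Λ) (b : Site d), (a : Site d) ≠ b →
      (openGraph (ξ \ ↑(edgesIn (zdGraph d) Λ))).Reachable a b → (a : Site d) ∈ innerBoundary (zdGraph d) Λ := by
    intro a b hne h
    obtain ⟨w⟩ := h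
    cases w with
    | nil => exact absurd rfl hne
    | cons hav _ => exact hfirst a _ hav
  intro a b hab
  rw [SimpleGraph.comap_adj, fromRel_reachable_adj] at hab
  rw [wired_adj, mem_wiredBoundary_iff, mem_wiredBoundary_iff]
  refine ⟨fun h => hab.1 (congrArg Subtype.val h), hstart a b hab.1 hab.2, ?_⟩
  exact hstart b a (Ne.symm hab.1) hab.2.symm

/-- **Pointwise upper kernel comparison** (Grimmett 2006, Lemma (4.14)(b), wired side, general boundary
condition): for `0 ≤ p ≤ 1`, `q ≥ 1`, a finite region `Λ`, a LATTICE configuration `ξ` and an increasing event `A`,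
`∑_{η ⊆ E_Λ, η ∈ A} φ^ξ_{Λ,p,q}(η) ≤ φ¹_{Λ,p,q}(A)`. [cite: Grimmett2006, Lemma (4.14)(b)] -/
theorem sum_ite_rcCondProb_le_regionWiredReal (hp : p ∈ Set.Icc (0 : ℝ) 1) (hq : 1 ≤ q) (Λ : Finset (Site d))
    {ξ : BondConfig (Site d)} (hξ : ξ ⊆ (zdGraph d).edgeSet) {A : Set (BondConfig (Site d))}
    [DecidablePred (· ∈ A)] (hA : IsUpperSet A) :
    ∑ η ∈ (edgesIn (zdGraph d) Λ).powerset, (if (↑η : BondConfig (Site d)) ∈ A then rcCondProb p q Λ ξ η else 0) ≤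
      regionWiredReal d p q Λ A := by
  classical
  have hq0 : 0 < q := one_pos.trans_le hq
  set U := edgesIn (zdGraph d) Λ with hU
  set R' : SimpleGraph ↥Λ := (SimpleGraph.fromRel (openGraph (ξ \ ↑U)).Reachable).comap (Subtype.val : ↥Λ → Site d)
    with hR'
  set W : SimpleGraph ↥Λ := wired (wiredBoundary (zdGraph d) Λ) with hW
  have hRW : wired (∅ : Set ↥Λ) ⊔ R' ≤ W := by
    rw [wired_empty, bot_sup_eq]
    exact comap_fromRel_reachable_le_wired_wiredBoundary Λ hξ
  set k : Finset (Sym2 (Site d)) → ℕ := fun η =>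
    Nat.card ((openGraph (↑η : BondConfig (Site d))).comap (Subtype.val : ↥Λ → Site d) ⊔
      (wired (∅ : Set ↥Λ) ⊔ R')).ConnectedComponent with hk
  set k' : Finset (Sym2 (Site d)) → ℕ := fun η =>
    Nat.card ((openGraph (↑η : BondConfig (Site d))).comap (Subtype.val : ↥Λ → Site d) ⊔ W).ConnectedComponent
    with hk'
  have hkW : ∀ η : Finset (Sym2 (Site d)),
      (openGraph (↑η : BondConfig (Site d))).comap (Subtype.val : ↥Λ → Site d) ⊔ ((wired (∅ : Set ↥Λ) ⊔ R') ⊔ W) =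
        (openGraph (↑η : BondConfig (Site d))).comap (Subtype.val : ↥Λ → Site d) ⊔ W := fun η => by
    rw [sup_eq_right.2 hRW]
  set f : Finset (Sym2 (Site d)) → ℝ := fun η => if (↑η : BondConfig (Site d)) ∈ A then 1 else 0 with hf
  have hf0 : ∀ η, 0 ≤ f η := fun η => by simp only [hf]; split_ifs <;> norm_num
  have hfmono : Monotone f := by
    intro a b hab
    simp only [hf]
    by_cases ha : (↑a : BondConfig (Site d)) ∈ A
    · rw [if_pos ha, if_pos (hA (Finset.coe_subset.2 hab) ha)]
    · rw [if_neg ha]; split_ifs <;> norm_num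
  have htilt := powerset_tilt_sum_mul_sum_le U hp hq k k'
    (fun a _ b _ => card_cc_comap_sup_supermodular Subtype.val (wired (∅ : Set ↥Λ) ⊔ R') a b)
    (fun a b hab _ => by
      have h := card_cc_comap_add_sup_le Subtype.val (wired (∅ : Set ↥Λ) ⊔ R') W hab
      simp only [hk, hk']
      rw [← hkW a, ← hkW b]
      exact h) hf0 hfmono
  set Z := ∑ η ∈ U.powerset, p ^ η.card * (1 - p) ^ (U \ η).card * q ^ k η with hZ
  set Z' := ∑ η ∈ U.powerset, p ^ η.card * (1 - p) ^ (U \ η).card * q ^ k' η with hZ'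
  have hZeq : Z = rcCondPartition p q Λ ξ := by
    rw [rcCondPartition_eq]
    refine Finset.sum_congr rfl fun η hη => ?_
    rw [rcCondWeight_eq_pow_card_comap_wired_empty p q Λ ξ (Finset.mem_powerset.1 hη)]
  have hZpos : 0 < Z := by rw [hZeq]; exact rcCondPartition_pos hp hq0 Λ ξ
  have hZ'eq : Z' = rcPartitionFunction (finsetGraph (zdGraph d) Λ) p q (wiredBoundary (zdGraph d) Λ) :=
    (rcPartitionFunction_finsetGraph_eq_sum Λ _).symm
  have hZ'pos : 0 < Z' := by rw [hZ'eq]; exact rcPartitionFunction_pos _ hp hq0 _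
  have hwired : regionWiredReal d p q Λ A =
      (∑ η ∈ U.powerset, p ^ η.card * (1 - p) ^ (U \ η).card * q ^ k' η * f η) / Z' := by
    rw [regionWiredReal_eq_sum_div hp hq0 Λ A]
    congr 1
    refine Finset.sum_congr rfl fun η _ => ?_
    simp only [hf]
    split_ifs
    · rw [mul_one]
    · rw [mul_zero]
  have hker : ∑ η ∈ U.powerset, (if (↑η : BondConfig (Site d)) ∈ A then rcCondProb p q Λ ξ η else 0) =
      (∑ η ∈ U.powerset, p ^ η.card * (1 - p) ^ (U \ η).card * q ^ k η * f η) / Z := by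
    rw [Finset.sum_div]
    refine Finset.sum_congr rfl fun η hη => ?_
    rw [rcCondProb_eq, ← hZeq, rcCondWeight_eq_pow_card_comap_wired_empty p q Λ ξ (Finset.mem_powerset.1 hη)]
    simp only [hf]
    split_ifs
    · rw [mul_one]
    · rw [mul_zero, zero_div]
  rw [hwired, hker, div_le_div_iff₀ hZpos hZ'pos]
  linarith [htilt]

/-! ### Lemma (4.14)(a): the kernel is increasing in the boundary condition -/

/-- The pulled-back connection graph is monotone in the configuration. [folklore] -/
theorem comap_fromRel_reachable_mono {ζ ζ' : BondConfig (Site d)} (h : ζ ⊆ ζ') (Λ : Finset (Site d)) :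
    (SimpleGraph.fromRel (openGraph ζ).Reachable).comap (Subtype.val : ↥Λ → Site d) ≤
      (SimpleGraph.fromRel (openGraph ζ').Reachable).comap (Subtype.val : ↥Λ → Site d) := by
  intro a b hab
  rw [SimpleGraph.comap_adj, fromRel_reachable_adj] at hab ⊢
  exact ⟨hab.1, hab.2.mono (openGraph_mono h)⟩

/-- **The specification kernel is increasing in the boundary condition** (Grimmett 2006, Lemma (4.14)(a) for the
kernel (4.12)): for `0 ≤ p ≤ 1`, `q ≥ 1`, a finite region `Λ`, configurations `ξ ⊆ ξ'` (ARBITRARY sets of pairs) and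
an increasing event `A`, `∑_{η ⊆ E_Λ, η ∈ A} φ^ξ_{Λ,p,q}(η) ≤ ∑_{η ⊆ E_Λ, η ∈ A} φ^{ξ'}_{Λ,p,q}(η)` — more outside
connections raise increasing expectations (the boundary-condition graph `R_ξ` is below `R_{ξ'}`).
[cite: Grimmett2006, Lemma (4.14)(a)] -/
theorem sum_ite_rcCondProb_mono (hp : p ∈ Set.Icc (0 : ℝ) 1) (hq : 1 ≤ q) (Λ : Finset (Site d))
    {ξ ξ' : BondConfig (Site d)} (hξ : ξ ⊆ ξ') {A : Set (BondConfig (Site d))} [DecidablePred (· ∈ A)]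
    (hA : IsUpperSet A) :
    ∑ η ∈ (edgesIn (zdGraph d) Λ).powerset, (if (↑η : BondConfig (Site d)) ∈ A then rcCondProb p q Λ ξ η else 0) ≤
      ∑ η ∈ (edgesIn (zdGraph d) Λ).powerset,
        (if (↑η : BondConfig (Site d)) ∈ A then rcCondProb p q Λ ξ' η else 0) := by
  classical
  have hq0 : 0 < q := one_pos.trans_le hq
  set U := edgesIn (zdGraph d) Λ with hU
  set R : SimpleGraph ↥Λ := wired (∅ : Set ↥Λ) ⊔
    (SimpleGraph.fromRel (openGraph (ξ \ ↑U)).Reachable).comap (Subtype.val : ↥Λ → Site d) with hR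
  set R' : SimpleGraph ↥Λ := wired (∅ : Set ↥Λ) ⊔
    (SimpleGraph.fromRel (openGraph (ξ' \ ↑U)).Reachable).comap (Subtype.val : ↥Λ → Site d) with hR'
  have hRR' : R ≤ R' :=
    sup_le_sup_left (comap_fromRel_reachable_mono
      (fun e (he : e ∈ ξ \ ↑U) => show e ∈ ξ' \ ↑U from ⟨hξ he.1, he.2⟩) Λ) _
  set k : Finset (Sym2 (Site d)) → ℕ := fun η =>
    Nat.card ((openGraph (↑η : BondConfig (Site d))).comap (Subtype.val : ↥Λ → Site d) ⊔ R).ConnectedComponent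
    with hk
  set k' : Finset (Sym2 (Site d)) → ℕ := fun η =>
    Nat.card ((openGraph (↑η : BondConfig (Site d))).comap (Subtype.val : ↥Λ → Site d) ⊔ R').ConnectedComponent
    with hk'
  have hkR : ∀ η : Finset (Sym2 (Site d)),
      (openGraph (↑η : BondConfig (Site d))).comap (Subtype.val : ↥Λ → Site d) ⊔ (R ⊔ R') =
        (openGraph (↑η : BondConfig (Site d))).comap (Subtype.val : ↥Λ → Site d) ⊔ R' := fun η => by
    rw [sup_eq_right.2 hRR']
  set f : Finset (Sym2 (Site d)) → ℝ := fun η => if (↑η : BondConfig (Site d)) ∈ A then 1 else 0 with hf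
  have hf0 : ∀ η, 0 ≤ f η := fun η => by simp only [hf]; split_ifs <;> norm_num
  have hfmono : Monotone f := by
    intro a b hab
    simp only [hf]
    by_cases ha : (↑a : BondConfig (Site d)) ∈ A
    · rw [if_pos ha, if_pos (hA (Finset.coe_subset.2 hab) ha)]
    · rw [if_neg ha]; split_ifs <;> norm_num
  have htilt := powerset_tilt_sum_mul_sum_le U hp hq k k'
    (fun a _ b _ => card_cc_comap_sup_supermodular Subtype.val R a b)
    (fun a b hab _ => by
      have h := card_cc_comap_add_sup_le Subtype.val R R' hab
      simp only [hk, hk']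
      rw [← hkR a, ← hkR b]
      exact h) hf0 hfmono
  set Z := ∑ η ∈ U.powerset, p ^ η.card * (1 - p) ^ (U \ η).card * q ^ k η with hZ
  set Z' := ∑ η ∈ U.powerset, p ^ η.card * (1 - p) ^ (U \ η).card * q ^ k' η with hZ'
  have hZeq : Z = rcCondPartition p q Λ ξ := by
    rw [rcCondPartition_eq]
    refine Finset.sum_congr rfl fun η hη => ?_
    rw [rcCondWeight_eq_pow_card_comap_wired_empty p q Λ ξ (Finset.mem_powerset.1 hη)]
  have hZ'eq : Z' = rcCondPartition p q Λ ξ' := by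
    rw [rcCondPartition_eq]
    refine Finset.sum_congr rfl fun η hη => ?_
    rw [rcCondWeight_eq_pow_card_comap_wired_empty p q Λ ξ' (Finset.mem_powerset.1 hη)]
  have hZpos : 0 < Z := by rw [hZeq]; exact rcCondPartition_pos hp hq0 Λ ξ
  have hZ'pos : 0 < Z' := by rw [hZ'eq]; exact rcCondPartition_pos hp hq0 Λ ξ'
  have hker : ∀ (ζ : BondConfig (Site d)) (kk : Finset (Sym2 (Site d)) → ℕ) (ZZ : ℝ),
      ZZ = rcCondPartition p q Λ ζ →
      (∀ η ∈ U.powerset, rcCondWeight p q Λ ζ η = p ^ η.card * (1 - p) ^ (U \ η).card * q ^ kk η) →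
      ∑ η ∈ U.powerset, (if (↑η : BondConfig (Site d)) ∈ A then rcCondProb p q Λ ζ η else 0) =
        (∑ η ∈ U.powerset, p ^ η.card * (1 - p) ^ (U \ η).card * q ^ kk η * f η) / ZZ := by
    intro ζ kk ZZ hZZ hw
    rw [Finset.sum_div]
    refine Finset.sum_congr rfl fun η hη => ?_
    rw [rcCondProb_eq, ← hZZ, hw η hη]
    simp only [hf]
    split_ifs
    · rw [mul_one]
    · rw [mul_zero, zero_div]
  rw [hker ξ k Z hZeq fun η hη => rcCondWeight_eq_pow_card_comap_wired_empty p q Λ ξ (Finset.mem_powerset.1 hη),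
    hker ξ' k' Z' hZ'eq fun η hη => rcCondWeight_eq_pow_card_comap_wired_empty p q Λ ξ' (Finset.mem_powerset.1 hη),
    div_le_div_iff₀ hZpos hZ'pos]
  linarith [htilt]

end Summit.CriticalPhenomena.PercolationContinuityZ3.Theorems.FK

end
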